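import Mathlib
import HarnessLib
import Summits.Ventures.LatticeQCDFlow.Scoring.CalibrationTruths

/-!
# The V9 sticking floor: scorer A's closed form equals the T2-R′ series

HONEST FRAMING: exact (Metropolis-corrected) sampling algorithms for lattice gauge theory;
figures of merit are autocorrelation/cost numbers at stated couplings and volumes; no
continuum-physics claim.

Venture `LatticeQCDFlow` (cell pub-lqcd), sub-topic `Scoring`; FANOUT row 11 (`eng-scorerA`,
fitness scorer A).  NEW WORK of the cell (the arithmetic of one validity test in the frozen
scorer), not a published result; nothing is cited as a fact.

## Content

The frozen fitness scorer A 0.1.2 (identity `366a0413…`) carries one validity test that rests on a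
theorem of the cell rather than on an oracle table: `V9:tau-below-sticking-floor:<k>`
(`scorerA/score.py` l.728–760; HOME/eng-scorera/V9-STICKING-FLOOR-A012.md; the same formula is
used by scorer B 0.1.8 since RB-19).  For an EXACT independence-Metropolis chain, a topological
sector `A` with target mass `p = π(A)` and proposal (model) mass `q = q(A)`, theory-2's T2-R′
(`Summit.Ventures.LatticeQCDFlow.Exactness.sector_joint_lower_bound`, `Exactness/FlowMCMC.lean`)
gives `P(X₀ ∈ A, X_t ∈ A) ≥ p · (1 − q/p)₊ᵗ` at stationarity, i.e. the lag-`t` autocorrelation of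
the sector indicator obeys `ρ_t ≥ (bᵗ − p)/(1 − p)` with `b = (1 − q/p)₊`.  The scorer turns this
into a floor under `τ_int(1_A) = ½ + Σ_{t ≥ 1} ρ_t`,

  `floor(p, b) = ½ + Σ_{t ≥ 1} (bᵗ − p)₊ / (1 − p)`                          (`stickingFloor`)

(the positive part uses `ρ_t ≥ 0`, true for independence samplers — their transition operator is
positive — and an INPUT of `stickingFloor_le_tauInt` below, not proved here), and evaluates the
series by the closed form coded at score.py l.735–741,

  `T = ⌊log p / log b⌋`,   `floor = ½ + ( b (1 − bᵀ)/(1 − b) − p·T ) / (1 − p)`   (`stickingFloorClosed`),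

raising HARD `V9` when the measured `τ̂_ind(k)` lies more than `3 δτ̂` BELOW the floor.  This file
checks that arithmetic, once, in the kernel:

* `floorTerm_eq_sub` / `floorTerm_eq_zero` — the summand is `bᵗ − p` for `t ≤ T` and `0` for
  `t > T` as soon as `b^(T+1) ≤ p ≤ bᵀ` (`0 ≤ b ≤ 1`);
* `natFloor_log_div_log_spec` — the code's `T = ⌊log p / log b⌋₊` satisfies exactly that bracket
  for `0 < b < 1`, `0 < p < 1` (its comment 'last t with b^t > p' is right up to the tie `bᵀ = p`,
  whose summand is `0` either way — `stickingFloor_quarter_half` evaluates such a tie both ways);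
* `stickingFloor_eq_closed` — **series = closed form** under the bracket; hence
  `stickingFloor_eq_scorerA` with the code's own `b = 1 − q/p` and `T`, for `0 < q < p < 1`; the
  code's `if T ≥ 1` guard only skips a bracket that is `0` anyway (`stickingFloorClosed_zero`);
* `stickingFloor_vacuous` — `q ≥ p` gives `b = 0` and floor `= ½`: an over-proposed sector cannot
  be shown to stick by this argument.  This is the RB-19 lesson (`stickingFloor_rb19`): scorer B
  ≤ 0.1.7 applied the `q ≪ p` asymptote `½ + c·p/q` unconditionally and raised a false HARD on a
  VALID chain at `p̂ = 0.01139 < q̂ = 0.01680`, where the floor is `½`;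
* `half_le_stickingFloor`, `stickingFloor_le`, `stickingFloor_le_pq` —
  `½ ≤ floor ≤ ½ + b/((1 − b)(1 − p)) = ½ + (p − q)/(q (1 − p))`: the floor is `O(p/q)`, the
  'frozen for ≍ p/q steps' of T2-R′, however high the mean acceptance;
* `acf_lower_of_joint_lower` — T2-R′'s two-time form `P(X₀ ∈ A, X_t ∈ A) ≥ p·bᵗ` is the ACF form
  `ρ_t ≥ (bᵗ − p)/(1 − p)` (indicator variance `p (1 − p)`);
* `stickingFloor_le_tauInt` — given the two inputs `ρ_t ≥ (bᵗ − p)/(1 − p)` (T2-R′) and `ρ_t ≥ 0`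
  and a summable ACF, `floor ≤ τ_int(ρ)` (`tauInt` of `CalibrationTruths`): the inequality the HARD
  token tests a measured `τ̂_ind ± δτ̂` against.
-/

namespace Summit.Ventures.LatticeQCDFlow.Scoring

open Finset

/-! ### The summand and its bracket -/

/-- The lag-`t` summand of the floor: `(bᵗ − p)₊`. -/
noncomputable def floorTerm (p b : ℝ) (t : ℕ) : ℝ :=
  max 0 (b ^ t - p)

/-- The summand is nonnegative. -/
theorem floorTerm_nonneg (p b : ℝ) (t : ℕ) : 0 ≤ floorTerm p b t :=
  le_max_left _ _

/-- The summand is at most `bᵗ` (for `0 ≤ b`, `0 ≤ p`). -/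
theorem floorTerm_le_pow {p b : ℝ} (hb0 : 0 ≤ b) (hp0 : 0 ≤ p) (t : ℕ) :
    floorTerm p b t ≤ b ^ t :=
  max_le (pow_nonneg hb0 _) (by linarith)

/-- Inside the bracket (`t ≤ T` with `p ≤ bᵀ`, `0 ≤ b ≤ 1`): the summand is `bᵗ − p`. -/
theorem floorTerm_eq_sub {p b : ℝ} (hb0 : 0 ≤ b) (hb1 : b ≤ 1) {T t : ℕ} (ht : t ≤ T)
    (hT : p ≤ b ^ T) : floorTerm p b t = b ^ t - p := by
  have : b ^ T ≤ b ^ t := pow_le_pow_of_le_one hb0 hb1 ht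
  unfold floorTerm
  exact max_eq_right (by linarith)

/-- Beyond the bracket (`T < t` with `b^(T+1) ≤ p`, `0 ≤ b ≤ 1`): the summand vanishes. -/
theorem floorTerm_eq_zero {p b : ℝ} (hb0 : 0 ≤ b) (hb1 : b ≤ 1) {T t : ℕ} (ht : T < t)
    (hT' : b ^ (T + 1) ≤ p) : floorTerm p b t = 0 := by
  have : b ^ t ≤ b ^ (T + 1) := pow_le_pow_of_le_one hb0 hb1 (Nat.succ_le_of_lt ht)
  unfold floorTerm
  exact max_eq_left (by linarith)

/-! ### The floor: series and closed form -/

/-- **The V9 sticking floor** as the series `½ + Σ_{t ≥ 1} (bᵗ − p)₊ / (1 − p)`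
(score.py l.733 comment; THEORY-2 T2-R′ with the positive part). -/
noncomputable def stickingFloor (p b : ℝ) : ℝ :=
  1 / 2 + (∑' t : ℕ, floorTerm p b (t + 1)) / (1 - p)

/-- **Scorer A's closed form** with bracket index `T` (score.py l.738–741):
`½ + ( b (1 − bᵀ)/(1 − b) − p·T ) / (1 − p)`. -/
noncomputable def stickingFloorClosed (p b : ℝ) (T : ℕ) : ℝ :=
  1 / 2 + (b * (1 - b ^ T) / (1 - b) - p * T) / (1 - p)

/-- At `T = 0` the closed form is `½` — the value the code keeps when its `if T ≥ 1` guard skips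
the bracket. -/
theorem stickingFloorClosed_zero (p b : ℝ) : stickingFloorClosed p b 0 = 1 / 2 := by
  simp [stickingFloorClosed]

/-- Under the bracket the series has finite support: it is the finite sum over `t = 1 … T`. -/
theorem tsum_floorTerm_eq_sum {p b : ℝ} (hb0 : 0 ≤ b) (hb1 : b ≤ 1) {T : ℕ}
    (hT : p ≤ b ^ T) (hT' : b ^ (T + 1) ≤ p) :
    ∑' t : ℕ, floorTerm p b (t + 1) = ∑ t ∈ range T, (b ^ (t + 1) - p) := by
  rw [tsum_eq_sum (s := range T)]
  · refine sum_congr rfl fun t ht => ?_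
    rw [mem_range] at ht
    exact floorTerm_eq_sub hb0 hb1 (Nat.succ_le_of_lt ht) hT
  · intro t ht
    rw [mem_range, not_lt] at ht
    exact floorTerm_eq_zero hb0 hb1 (Nat.lt_succ_of_le ht) hT'

/-- The finite sum in closed form (`b ≠ 1`): `Σ_{t=1}^{T} (bᵗ − p) = b (1 − bᵀ)/(1 − b) − p T`. -/
theorem sum_range_pow_succ_sub {p b : ℝ} (hb1 : b ≠ 1) (T : ℕ) :
    ∑ t ∈ range T, (b ^ (t + 1) - p) = b * (1 - b ^ T) / (1 - b) - p * T := by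
  have hg : ∑ t ∈ range T, b ^ (t + 1) = b * ∑ t ∈ range T, b ^ t := by
    rw [mul_sum]
    exact sum_congr rfl fun t _ => by ring
  rw [sum_sub_distrib, sum_const, card_range, nsmul_eq_mul, hg, geom_sum_eq hb1 T]
  have h1 : (1 : ℝ) - b ≠ 0 := sub_ne_zero.mpr (Ne.symm hb1)
  have h2 : b - 1 ≠ 0 := sub_ne_zero.mpr hb1
  field_simp
  ring

/-- **Series = closed form** under the bracket `b^(T+1) ≤ p ≤ bᵀ`, `0 ≤ b < 1`. -/
theorem stickingFloor_eq_closed {p b : ℝ} (hb0 : 0 ≤ b) (hb1 : b < 1) {T : ℕ}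
    (hT : p ≤ b ^ T) (hT' : b ^ (T + 1) ≤ p) :
    stickingFloor p b = stickingFloorClosed p b T := by
  unfold stickingFloor stickingFloorClosed
  rw [tsum_floorTerm_eq_sum hb0 hb1.le hT hT', sum_range_pow_succ_sub hb1.ne T]

/-! ### The code's bracket index `T = ⌊log p / log b⌋` -/

/-- `T = ⌊log p / log b⌋₊` brackets `p`: `b^(T+1) < p ≤ bᵀ` for `0 < b < 1`, `0 < p < 1`
(the code comment 'last t with b^t > p' up to the tie `bᵀ = p`). -/
theorem natFloor_log_div_log_spec {p b : ℝ} (hb0 : 0 < b) (hb1 : b < 1) (hp0 : 0 < p)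
    (hp1 : p < 1) :
    p ≤ b ^ ⌊Real.log p / Real.log b⌋₊ ∧ b ^ (⌊Real.log p / Real.log b⌋₊ + 1) < p := by
  have hlb : Real.log b < 0 := Real.log_neg hb0 hb1
  have hlp : Real.log p < 0 := Real.log_neg hp0 hp1
  have hx0 : 0 ≤ Real.log p / Real.log b := (div_pos_of_neg_of_neg hlp hlb).le
  set T := ⌊Real.log p / Real.log b⌋₊ with hTdef
  have hT1 : (T : ℝ) ≤ Real.log p / Real.log b := Nat.floor_le hx0
  have hT2 : Real.log p / Real.log b < T + 1 := Nat.lt_floor_add_one _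
  constructor
  · have h : Real.log p ≤ (T : ℝ) * Real.log b := (le_div_iff_of_neg hlb).mp hT1
    calc p = Real.exp (Real.log p) := (Real.exp_log hp0).symm
      _ ≤ Real.exp ((T : ℝ) * Real.log b) := Real.exp_le_exp.mpr h
      _ = b ^ T := by rw [← Real.log_pow, Real.exp_log (pow_pos hb0 T)]
  · have h : ((T : ℝ) + 1) * Real.log b < Real.log p := (div_lt_iff_of_neg hlb).mp hT2
    calc b ^ (T + 1) = Real.exp (((T : ℝ) + 1) * Real.log b) := by
          rw [← Real.exp_log (pow_pos hb0 (T + 1)), Real.log_pow]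
          push_cast
          ring_nf
      _ < Real.exp (Real.log p) := Real.exp_lt_exp.mpr h
      _ = p := Real.exp_log hp0

/-- **Scorer A's V9 floor IS the T2-R′ series**: with the code's `b = 1 − q/p` and
`T = ⌊log p / log b⌋` (score.py l.735–741), for `0 < q < p < 1`,
`½ + Σ_{t≥1} (bᵗ − p)₊/(1 − p) = ½ + (b (1 − bᵀ)/(1 − b) − p T)/(1 − p)`. -/
theorem stickingFloor_eq_scorerA {p q : ℝ} (hq0 : 0 < q) (hqp : q < p) (hp1 : p < 1) :
    stickingFloor p (1 - q / p) =
      stickingFloorClosed p (1 - q / p) ⌊Real.log p / Real.log (1 - q / p)⌋₊ := by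
  have hp0 : 0 < p := hq0.trans hqp
  have hb0 : 0 < 1 - q / p := by rw [sub_pos, div_lt_one hp0]; exact hqp
  have hb1 : 1 - q / p < 1 := by have := div_pos hq0 hp0; linarith
  obtain ⟨hT, hT'⟩ := natFloor_log_div_log_spec hb0 hb1 hp0 hp1
  exact stickingFloor_eq_closed hb0.le hb1 hT hT'.le

/-- A tie evaluated both ways: `p = 1/4`, `b = 1/2` (`b² = p` exactly).  The bracket holds for
`T = 1` (`b² ≤ p ≤ b¹`) AND for the code's `T = ⌊log ¼ / log ½⌋ = 2` (`b³ ≤ p ≤ b²`); both closed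
forms equal the series `½ + ((½ − ¼) + 0)/(¾) = 5/6`. -/
theorem stickingFloor_quarter_half :
    stickingFloor (1 / 4) (1 / 2) = 5 / 6 ∧ stickingFloorClosed (1 / 4) (1 / 2) 1 = 5 / 6 ∧
      stickingFloorClosed (1 / 4) (1 / 2) 2 = 5 / 6 := by
  have h1 : stickingFloorClosed (1 / 4) (1 / 2) 1 = 5 / 6 := by
    unfold stickingFloorClosed; norm_num
  have h2 : stickingFloorClosed (1 / 4) (1 / 2) 2 = 5 / 6 := by
    unfold stickingFloorClosed; norm_num
  refine ⟨?_, h1, h2⟩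
  rw [stickingFloor_eq_closed (T := 1) (by norm_num) (by norm_num) (by norm_num) (by norm_num)]
  exact h1

/-! ### The vacuous side `q ≥ p` (RB-19) -/

/-- With `b = 0` every summand `(0 − p)₊` (`t ≥ 1`) vanishes: floor `= ½` (`0 ≤ p`). -/
theorem stickingFloor_zero_b {p : ℝ} (hp0 : 0 ≤ p) : stickingFloor p 0 = 1 / 2 := by
  unfold stickingFloor
  have : ∀ t : ℕ, floorTerm p 0 (t + 1) = 0 := fun t => by
    unfold floorTerm
    rw [zero_pow (Nat.succ_ne_zero t)]
    exact max_eq_left (by linarith)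
  simp [this]

/-- **Over-proposed sector (`q ≥ p`): the floor is vacuous** — `b = (1 − q/p)₊ = 0` and
`floor = ½`; a model that over-proposes a sector cannot be shown to stick by T2-R′. -/
theorem stickingFloor_vacuous {p q : ℝ} (hp0 : 0 < p) (hpq : p ≤ q) :
    stickingFloor p (max 0 (1 - q / p)) = 1 / 2 := by
  have hb : max 0 (1 - q / p) = 0 :=
    max_eq_left (by rw [sub_nonpos, one_le_div hp0]; exact hpq)
  rw [hb]
  exact stickingFloor_zero_b hp0.le

/-- **RB-19 in numbers**: the kanwar24-valid sector `k = 4` had `p̂ = 0.01139 < q̂ = 0.01680`, so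
the floor of record is `½` (scorer A: status ok, `τ̂_ind = 0.7426 ± 0.0110 > ½`); B 0.1.7's
unconditional asymptote printed `0.8385` and a false HARD — fixed in B 0.1.8 by adopting this
formula. -/
theorem stickingFloor_rb19 :
    stickingFloor (1139 / 100000) (max 0 (1 - (1680 / 100000) / (1139 / 100000))) = 1 / 2 :=
  stickingFloor_vacuous (by norm_num) (by norm_num)

/-! ### Size of the floor -/

/-- `½ ≤ floor` (`p < 1`). -/
theorem half_le_stickingFloor {p : ℝ} (hp1 : p < 1) (b : ℝ) : 1 / 2 ≤ stickingFloor p b := by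
  unfold stickingFloor
  have h1 : 0 ≤ ∑' t : ℕ, floorTerm p b (t + 1) := tsum_nonneg fun t => floorTerm_nonneg p b _
  have h2 : 0 ≤ (∑' t : ℕ, floorTerm p b (t + 1)) / (1 - p) := div_nonneg h1 (by linarith)
  linarith

/-- The series is summable for `0 ≤ b < 1`, `0 ≤ p` (dominated by the geometric series). -/
theorem summable_floorTerm_succ {p b : ℝ} (hb0 : 0 ≤ b) (hb1 : b < 1) (hp0 : 0 ≤ p) :
    Summable fun t : ℕ => floorTerm p b (t + 1) :=
  Summable.of_nonneg_of_le (fun t => floorTerm_nonneg p b _) (fun t => floorTerm_le_pow hb0 hp0 _)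
    (hasSum_geometric_succ (abs_lt.mpr ⟨by linarith, hb1⟩)).summable

/-- **`floor ≤ ½ + b / ((1 − b)(1 − p))`** (`0 ≤ b < 1`, `0 ≤ p < 1`): drop `−p` and sum the
whole geometric tail. -/
theorem stickingFloor_le {p b : ℝ} (hb0 : 0 ≤ b) (hb1 : b < 1) (hp0 : 0 ≤ p) (hp1 : p < 1) :
    stickingFloor p b ≤ 1 / 2 + b / ((1 - b) * (1 - p)) := by
  have hgeom : HasSum (fun t : ℕ => b ^ (t + 1)) (b / (1 - b)) :=
    hasSum_geometric_succ (abs_lt.mpr ⟨by linarith, hb1⟩)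
  have h1 : ∑' t : ℕ, floorTerm p b (t + 1) ≤ b / (1 - b) := by
    rw [← hgeom.tsum_eq]
    exact (summable_floorTerm_succ hb0 hb1 hp0).tsum_le_tsum (fun t => floorTerm_le_pow hb0 hp0 _)
      hgeom.summable
  have h2 : 0 < 1 - p := by linarith
  have h3 : (∑' t : ℕ, floorTerm p b (t + 1)) / (1 - p) ≤ b / (1 - b) / (1 - p) :=
    div_le_div_of_nonneg_right h1 h2.le
  rw [div_div] at h3
  unfold stickingFloor
  linarith

/-- … at the code's `b = 1 − q/p` (`0 < q ≤ p < 1`): `floor ≤ ½ + (p − q)/(q (1 − p))` — the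
floor is `O(p/q)`, T2-R′'s 'topologically frozen for ≍ p(A)/q(A) steps'. -/
theorem stickingFloor_le_pq {p q : ℝ} (hq0 : 0 < q) (hqp : q ≤ p) (hp1 : p < 1) :
    stickingFloor p (1 - q / p) ≤ 1 / 2 + (p - q) / (q * (1 - p)) := by
  have hp0 : 0 < p := hq0.trans_le hqp
  have hb0 : 0 ≤ 1 - q / p := by rw [sub_nonneg, div_le_one hp0]; exact hqp
  have hb1 : 1 - q / p < 1 := by have := div_pos hq0 hp0; linarith
  have h := stickingFloor_le hb0 hb1 hp0.le hp1
  have heq : (1 - q / p) / ((1 - (1 - q / p)) * (1 - p)) = (p - q) / (q * (1 - p)) := by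
    have h1p : (1 : ℝ) - p ≠ 0 := ne_of_gt (by linarith)
    have hq : q ≠ 0 := hq0.ne'
    have hp : p ≠ 0 := hp0.ne'
    have hden : (1 - (1 - q / p)) * (1 - p) = q / p * (1 - p) := by ring
    have hL : q / p * (1 - p) ≠ 0 := mul_ne_zero (div_ne_zero hq hp) h1p
    have hR : q * (1 - p) ≠ 0 := mul_ne_zero hq h1p
    rw [hden, div_eq_div_iff hL hR]
    field_simp
  rw [heq] at h
  exact h

/-! ### What the HARD token tests -/

/-- From T2-R′'s joint-probability form to the ACF form: for a stationary indicator with mean `p`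
(`0 < p < 1`, variance `p (1 − p)`), a two-time bound `P(X₀ ∈ A, X_t ∈ A) ≥ p·c` gives
`ρ_t = (P(X₀ ∈ A, X_t ∈ A) − p²)/(p (1 − p)) ≥ (c − p)/(1 − p)` (used with `c = bᵗ`). -/
theorem acf_lower_of_joint_lower {p c J : ℝ} (hp0 : 0 < p) (hp1 : p < 1) (hJ : p * c ≤ J) :
    (c - p) / (1 - p) ≤ (J - p ^ 2) / (p * (1 - p)) := by
  have h1p : 0 < 1 - p := by linarith
  rw [div_le_div_iff₀ h1p (mul_pos hp0 h1p)]
  nlinarith [mul_le_mul_of_nonneg_right hJ h1p.le]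

/-- **`floor ≤ τ_int` under the two inputs.**  If the sector-indicator ACF `ρ` satisfies T2-R′'s
bound `ρ_t ≥ (bᵗ − p)/(1 − p)` (`t ≥ 1`), is nonnegative (independence samplers have a positive
transition operator, so every stationary autocorrelation is `≥ 0` — an input here, not proved in
this file) and is summable, then `floor(p, b) ≤ τ_int(ρ) = ½ + Σ_{t≥1} ρ_t`.  A measured
`τ̂_ind(k)` significantly BELOW the floor therefore contradicts exactness of the IMH chain —
scorer A's HARD `V9:tau-below-sticking-floor:<k>` at `z > 3`. -/
theorem stickingFloor_le_tauInt {p b : ℝ} (hp1 : p < 1) {ρ : ℕ → ℝ}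
    (hbound : ∀ t : ℕ, (b ^ (t + 1) - p) / (1 - p) ≤ ρ (t + 1)) (hpos : ∀ t : ℕ, 0 ≤ ρ (t + 1))
    (hsum : Summable fun t : ℕ => ρ (t + 1)) :
    stickingFloor p b ≤ tauInt ρ := by
  have h1p : 0 < 1 - p := by linarith
  have hle : ∀ t : ℕ, floorTerm p b (t + 1) / (1 - p) ≤ ρ (t + 1) := fun t => by
    unfold floorTerm
    rcases le_total 0 (b ^ (t + 1) - p) with h | h
    · rw [max_eq_right h]; exact hbound t
    · rw [max_eq_left h, zero_div]; exact hpos t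
  have hsumF : Summable fun t : ℕ => floorTerm p b (t + 1) / (1 - p) :=
    Summable.of_nonneg_of_le (fun t => div_nonneg (floorTerm_nonneg p b _) h1p.le) hle hsum
  have h := hsumF.tsum_le_tsum hle hsum
  rw [tsum_div_const] at h
  unfold stickingFloor tauInt
  linarith

end Summit.Ventures.LatticeQCDFlow.Scoring
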